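import Literature.AlgebraicGeometry.Pohlmann1968.SimpleCMAbelianVarietyHazamaCriterion
import Literature.AlgebraicGeometry.Pohlmann1968.SimpleDegenerateCMAbelianVarietiesCompositeDimensionExist
import Literature.AlgebraicGeometry.Pohlmann1968.MumfordSimpleFourfold
import Literature.AlgebraicGeometry.Pohlmann1968.NondegenerateCMTypeDivisorGenerated
import Literature.AlgebraicGeometry.Milne1999.CodesHCOfCMHodgeHypothesis
import HarnessLib

/-!
# The dimensions of simple degenerate abelian varieties of CM type: exactly the composite numbers
# (Ribet 1983 / Ribet 1980 (3.7) / Mumford–Pohlmann 1968 / Dodson 1984), ON THE VARIETY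

Family `hodge`, layer `Literature/AlgebraicGeometry/Pohlmann1968`; KERNEL ONLY (theorems; no definition, no named
fact; D-0026).  Cell `pub-hodgecm2` (COR-CM), count-neutral, literature seat `lit-deligne` gen 40 (Deligne 1982,
*Hodge cycles on abelian varieties*, I §5 / Example 3.7: the condition on the CM type — nondegenerate versus
exceptional classes — continued; claim D82-SIMPLE-CM-DICHOTOMY).

## The print

B. Dodson, *The structure of Galois groups of CM-fields*, Trans. AMS **283** (1984) [Dodson1984] (held
`paper:doi-10-2307-1999987`), abstract (p0001 L21–22): «simple degenerate Abelian varieties of CM-type are constructed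
in every composite dimension», and p. 2 (p0001 L45–47): «An Abelian variety `A` with complex multiplication of type
`(K, Φ)` is called degenerate when the rank `t(Φ)` … is less than the maximal value of `n + 1`. … While several
degenerate cases with `A` simple have been constructed, Ribet [15] proves that there are no such examples with
`n = p`, for `p` a prime.  In §3 a converse to Ribet's Theorem is proved by constructing simple degenerate Abelian
varieties in every composite dimension.»  ([15] = [Ribet1983]; dimension `4` is Dodson's §3.3.2 and, earlier,
Mumford's example of Pohlmann 1968 §3 = van Geemen 1994 Thm. 4.5 «There exist simple four dimensional abelian
varieties with `B² ≠ D²`»; dimensions `≤ 3` are Ribet 1980, Examples (3.7).)  With Hazama's criterion (Gordon 1999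
Thm. 6.4: for `A` simple of CM type, `Hdg(Aⁿ) = Div(Aⁿ)` for all `n` iff `dim MT(A) = dim A + 1`) «degenerate» is
the same as «some power carries an exceptional Hodge class».

## What the tree had, and what this file adds

Every ingredient is a tree THEOREM, each for its own range of dimensions:

* `isDivisorGenerated_powSucc_of_isSimple_of_isOfCMType_of_prime` (Ribet 1983 / Yanai, CM case of Tankeev–Ribet)
  and `…_of_dim_le_three` (Ribet 1980 (3.7)) — `Pohlmann1968/SimpleCMAbelianVarietyPowersDivisorGenerated`;
* `MumfordFourfold.isSimple_and_exists_exceptional` (Mumford–Pohlmann: `K = ℚ(α, i)`, `3α⁴ − 6α² + α + 1 = 0`,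
  Weil-`(2,2)` CM types) — `Pohlmann1968/MumfordSimpleFourfold`;
* `exists_primitive_degenerate_cmType_of_eq_mul` / `exists_eq_mul_of_not_prime` (Dodson §3.2.1, every composite
  `n > 4`) — `Pohlmann1968/SimpleDegenerateCMAbelianVarietiesCompositeDimensionExist`;
* Hazama's criterion on realisations (`isNondegenerate_iff_forall_isDivisorGenerated_pow`) and on the variety
  (`forall_isDivisorGenerated_powSucc_iff_mtRank_eq'`, `mtRank_hodge_one_le_dim_add_one`), powers versus biproducts
  (`forall_isDivisorGenerated_biproduct_iff`), and `IsCMTypeRealisation.isOfCMType`.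

This file ASSEMBLES them into the printed dichotomy, stated on the abelian variety (`X.IsSimple`,
`Milne1999.IsOfCMType X` — the binder of `HC_CM` —, `dim X = n`), in two vocabularies:

* `exists_isSimple_isOfCMType_not_isDivisorGenerated_powSucc_iff` — **for `n ≥ 1`: a SIMPLE complex abelian
  variety of CM type and dimension `n` SOME POWER OF WHICH IS NOT DIVISOR-GENERATED (`B•(X^{N+1}) ≠ D•(X^{N+1})`:
  an exceptional Hodge class) exists iff `n` is composite** (`¬ n.Prime ∧ 4 ≤ n`);
* `exists_isSimple_isOfCMType_mtRank_lt_iff` — the same with «degenerate» in Dodson's sense,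
  `dim MT(H¹(X)) < dim X + 1` (Mumford–Tate rank of the `ℚ`-Hodge structure on `H¹(X(ℂ); ℚ)`).

The direction «composite ⟹ exists» is granted the existence of abelian varieties of every CM type (Shimura 1998
§6.2 Thm. 3 = the tree's record `PicardCM.CMAbelianVarietyRealised`, a HYPOTHESIS `hreal` here exactly as in the
Dodson and Mumford files; a theorem Summits-side, `CorCM.cmAbelianVarietyRealised_holds`).  The direction
«exists ⟹ composite» is hypothesis-free (`not_prime_and_four_le_dim_of_not_isDivisorGenerated_powSucc`), as is its
contrapositive `isDivisorGenerated_powSucc_of_dim_prime_or_le_three` with the Hodge conjecture for all powers of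
simple CM abelian varieties of prime dimension or of dimension `≤ 3` (`hodgeConjectureFor_powSucc_of_dim_prime_or_le_three`).

Not here (not in print in this form / not needed): which powers carry the exceptional classes (for `n = 4` the
variety itself, `exists_isSimple_isOfCMType_fourfold_not_isDivisorGenerated`; for Dodson's types some power), the
list of ranks that occur (Dodson §5.3), non-simple varieties (Moonen–Zarhin 1999, tree `CorCM/CMAbelian*`).

## References

* [Dodson1984] B. Dodson, *The structure of Galois groups of CM-fields*, Trans. AMS 283 (1984) 1–32: abstract,
  p. 2, §3.2.1 Theorem, §3.3.2.
* [Ribet1983] K. A. Ribet, *Hodge classes on certain types of abelian varieties*, Amer. J. Math. 105 (1983), Thms. 0–3.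
* [Ribet1980] K. A. Ribet, *Division fields of abelian varieties with complex multiplication*, Mém. SMF 2 (1980),
  §3 Examples (3.7).
* [Pohlmann1968] H. Pohlmann, Ann. of Math. (2) 88 (1968) 161–180, Thm. 1 and §3 (Mumford's example).
* [vanGeemen1994HodgeAV] B. van Geemen, LNM 1594 (1994), Thm. 4.5, Thm. 4.6, 4.7.
* [Gordon1999HodgeAVSurvey] B. B. Gordon, *A survey of the Hodge conjecture for abelian varieties* (1999), Thm. 6.3
  with Corollary and Remark, Thm. 6.4, 8.2, 9.1–9.3.
* [Hazama1983] F. Hazama, *Hodge cycles on abelian varieties of CM-type*, Res. Act. Fac. Engrg. Tokyo Denki Univ. 5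
  (1983) 31–33, Theorem.
* [Yanai1985] H. Yanai, *On the rank of CM-type*, Nagoya Math. J. 97 (1985), §4 Theorem.
* [Shimura1998] G. Shimura, *Abelian Varieties with Complex Multiplication and Modular Functions* (1998), §6.2 Thm. 3,
  §8.2 Prop. 26.
* [Deligne1982HodgeCycles] P. Deligne, *Hodge cycles on abelian varieties*, LNM 900 (1982), I Example 3.7 and §5.
-/

set_option autoImplicit false

noncomputable section

open CategoryTheory NumberField

namespace Literature.AlgebraicGeometry.Pohlmann1968

open Literature.NumberTheory.ComplexMultiplication
open Literature.NumberTheory.NumberFields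
open Literature.AlgebraicGeometry.Motives (AbelianVariety CMType IsSmoothProjective hodgeTensorFacts_holds)
open Literature.AlgebraicGeometry.Motives.AbelianVariety
open Literature.AlgebraicGeometry.HodgeTheory
open Literature.AlgebraicGeometry.ComplexMultiplication (IsCMTypeRealisation)
open Literature.AlgebraicGeometry.Milne1999
open Literature.Barriers.HodgeConjecture (divisorClassesSpan)

/-! ### §1 Ribet's direction (hypothesis-free): exceptional classes on a power force a composite dimension -/

section Ribet

/-- **Ribet's theorem and Ribet 1980 (3.7), contrapositive form on the variety**: if a SIMPLE complex abelian
variety `X` of CM type has a power `X^{N+1}` which is NOT divisor-generated (`B•(X^{N+1}) ≠ D•(X^{N+1})`, i.e. an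
exceptional Hodge class), then `dim X` is COMPOSITE: not a prime («there are no such examples with `n = p`, for
`p` a prime») and at least `4` («if `d = 1, 2, 3` … `(E,S)` is always non-degenerate»).  UNCONDITIONAL.
[cite: Dodson1984, p. 2 («Ribet [15] proves that there are no such examples with n = p»)]
[cite: Ribet1983, Thms. 0–3] [cite: Ribet1980, §3 Examples (3.7)] [cite: Gordon1999HodgeAVSurvey, Thm. 6.3, Corollary and Remark] -/
theorem not_prime_and_four_le_dim_of_not_isDivisorGenerated_powSucc (X : AbelianVariety ℂ) (hs : X.IsSimple)
    (h0 : 0 < X.dim) (hcm : IsOfCMType X) {N : ℕ} (hN : ¬ IsDivisorGenerated (X.powSucc N)) :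
    ¬ X.dim.Prime ∧ 4 ≤ X.dim := by
  refine ⟨fun hp => hN (isDivisorGenerated_powSucc_of_isSimple_of_isOfCMType_of_prime X hp rfl hs hcm N), ?_⟩
  by_contra h
  exact hN (isDivisorGenerated_powSucc_of_isSimple_of_isOfCMType_of_dim_le_three X hs h0 (by omega) hcm N)

/-- **Every power of a simple complex abelian variety of CM type whose dimension is a prime or at most `3` is
divisor-generated** (`B•(X^{N+1}) = D•(X^{N+1})`; Tankeev–Ribet in the CM case = Yanai's theorem, and Ribet 1980
(3.7)), UNCONDITIONAL — the two tree theorems under one disjunction.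
[cite: Gordon1999HodgeAVSurvey, Thm. 6.3, Corollary and Remark] [cite: Ribet1980, §3 Examples (3.7)]
[cite: Yanai1985, §4 Theorem] -/
theorem isDivisorGenerated_powSucc_of_dim_prime_or_le_three (X : AbelianVariety ℂ) (hs : X.IsSimple)
    (h0 : 0 < X.dim) (hcm : IsOfCMType X) (h : X.dim.Prime ∨ X.dim ≤ 3) (N : ℕ) :
    IsDivisorGenerated (X.powSucc N) := by
  rcases h with hp | h3
  · exact isDivisorGenerated_powSucc_of_isSimple_of_isOfCMType_of_prime X hp rfl hs hcm N
  · exact isDivisorGenerated_powSucc_of_isSimple_of_isOfCMType_of_dim_le_three X hs h0 h3 hcm N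

/-- **The Hodge conjecture for every power of a simple complex abelian variety of CM type of prime dimension or of
dimension `≤ 3`** (all Hodge classes are combinations of intersections of divisors, hence algebraic by Lefschetz
`(1,1)`), UNCONDITIONAL. [cite: Gordon1999HodgeAVSurvey, Thm. 6.3 Corollary and §9.3]
[cite: Ribet1980, §3 Examples (3.7)] [cite: vanGeemen1994HodgeAV, §2.4 and Thm. 4.6] -/
theorem hodgeConjectureFor_powSucc_of_dim_prime_or_le_three (X : AbelianVariety ℂ) (hs : X.IsSimple)
    (h0 : 0 < X.dim) (hcm : IsOfCMType X) (h : X.dim.Prime ∨ X.dim ≤ 3) (N : ℕ) :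
    HodgeConjectureFor (X.powSucc N).dim (X.powSucc N).X :=
  hodgeConjectureFor_of_isDivisorGenerated _ (isDivisorGenerated_powSucc_of_dim_prime_or_le_three X hs h0 hcm h N)

end Ribet

/-! ### §2 The converse (Mumford–Pohlmann for `n = 4`, Dodson for composite `n > 4`), granted realisations -/

section Converse

/-- **Dimension `4`: Mumford's simple CM fourfolds with `B² ≠ D²`, on the variety** (Pohlmann 1968 §3; van Geemen
Thm. 4.5; Dodson §3.3.2).  Granted the existence of abelian varieties of every CM type (`hreal`, Shimura §6.2
Thm. 3), there is a SIMPLE complex abelian FOURFOLD `X` of CM type which is itself NOT divisor-generated: any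
realisation of Mumford's octic CM type `(ℚ(α, i); Φ_P)`, `3α⁴ − 6α² + α + 1 = 0`, `Φ_P` of Weil type `(2,2)` for
`ℚ(i)` (`MumfordFourfold.isSimple_and_exists_exceptional`). [cite: Pohlmann1968, §3] [cite: vanGeemen1994HodgeAV, Thm. 4.5 and 4.7]
[cite: Gordon1999HodgeAVSurvey, 8.2] [cite: Shimura1998, §6.2 Thm. 3 and §8.2 Prop. 26] -/
theorem exists_isSimple_isOfCMType_fourfold_not_isDivisorGenerated
    (hreal : Literature.NumberTheory.Automorphic.PicardCM.CMAbelianVarietyRealised) :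
    ∃ X : AbelianVariety ℂ, X.IsSimple ∧ IsOfCMType X ∧ X.dim = 4 ∧ ¬ IsDivisorGenerated X := by
  classical
  obtain ⟨P, -, hP⟩ := Finset.exists_subset_card_eq (s := (Finset.univ : Finset (MumfordQuartic.F →+* ℂ)))
    (n := 2) (by rw [Finset.card_univ, MumfordQuartic.card_embeddings]; norm_num)
  obtain ⟨A, ι, θ, h⟩ := hreal MumfordFourfold.K (MumfordFourfold.weilType P)
  have hA : IsCMTypeRealisation (MumfordFourfold.weilType P) A ι θ := h
  obtain ⟨hs, c, hcQ, hcH, hcD⟩ := MumfordFourfold.isSimple_and_exists_exceptional hP hA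
  have h4 : Module.finrank ℚ MumfordFourfold.K / 2 = 4 := by rw [MumfordFourfold.finrank_K]
  have hdim : A.dim = 4 := by
    have h2 := finrank_eq_two_mul_dim_of_isCMTypeRealisation hA
    rw [MumfordFourfold.finrank_K] at h2
    omega
  rw [h4] at hcH hcD
  refine ⟨A, hs, hA.isOfCMType, hdim, fun hD => hcD ?_⟩
  have hcH' : IsOfHodgeType A.dim A.X (2 * 2) 2 2 c := by rw [hdim]; exact hcH
  have hmem : c ∈ divisorClassesSpan A.X A.dim 2 := hD 2 c hcQ hcH'
  rw [hdim] at hmem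
  exact hmem

/-- **Composite dimension `n > 4`: Dodson 1984 §3.2.1 on the variety** («Let `n > 4` be composite … Then there
exist simple degenerate Abelian varieties of dimension `n`»).  Granted `hreal`, there is a SIMPLE complex abelian
variety `X` of CM type with `dim X = n` and a power `X^{N+1}` which is NOT divisor-generated: a realisation of
Dodson's primitive degenerate type (`exists_primitive_degenerate_cmType_of_eq_mul`) with Hazama's criterion
(`isNondegenerate_iff_forall_isDivisorGenerated_pow`). [cite: Dodson1984, §3.2.1 Theorem]
[cite: Gordon1999HodgeAVSurvey, Thm. 6.4] [cite: Shimura1998, §6.2 Thm. 3] -/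
theorem exists_isSimple_isOfCMType_not_isDivisorGenerated_powSucc_of_four_lt
    (hreal : Literature.NumberTheory.Automorphic.PicardCM.CMAbelianVarietyRealised) {n : ℕ} (h4 : 4 < n)
    (hn : ¬ n.Prime) :
    ∃ X : AbelianVariety ℂ, X.IsSimple ∧ IsOfCMType X ∧ X.dim = n ∧ ∃ N : ℕ, ¬ IsDivisorGenerated (X.powSucc N) := by
  obtain ⟨k, l, hk, hl, hkl⟩ := exists_eq_mul_of_not_prime h4 hn
  obtain ⟨K, _, _, _, Φ, φ₀, -, hprim, -, hdeg, hAV⟩ := exists_primitive_degenerate_cmType_of_eq_mul hk hl hkl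
  obtain ⟨A, ι, θ, h⟩ := hreal K Φ
  have hA : IsCMTypeRealisation Φ A ι θ := h
  obtain ⟨hs, hd, -⟩ := hAV A ι θ hA
  refine ⟨A, hs, hA.isOfCMType, hd, ?_⟩
  by_contra hall
  push Not at hall
  exact hdeg ((isNondegenerate_iff_forall_isDivisorGenerated_pow φ₀ hprim hA).2
    ((forall_isDivisorGenerated_biproduct_iff A).2 hall))

/-- **Dodson's converse to Ribet's theorem in every composite dimension** (abstract: «simple degenerate Abelian
varieties of CM-type are constructed in every composite dimension»), granted `hreal`: for `n ≥ 4` not a prime there is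
a SIMPLE complex abelian variety of CM type and dimension `n` some power of which is NOT divisor-generated
(`n = 4`: Mumford–Pohlmann, the variety itself; `n > 4`: Dodson §3.2.1). [cite: Dodson1984, abstract and §3.2.1 Theorem]
[cite: Pohlmann1968, §3] [cite: vanGeemen1994HodgeAV, Thm. 4.5] -/
theorem exists_isSimple_isOfCMType_not_isDivisorGenerated_powSucc_of_not_prime
    (hreal : Literature.NumberTheory.Automorphic.PicardCM.CMAbelianVarietyRealised) {n : ℕ} (h4 : 4 ≤ n)
    (hn : ¬ n.Prime) :
    ∃ X : AbelianVariety ℂ, X.IsSimple ∧ IsOfCMType X ∧ X.dim = n ∧ ∃ N : ℕ, ¬ IsDivisorGenerated (X.powSucc N) := by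
  rcases h4.eq_or_lt with h | h
  · subst h
    obtain ⟨X, hs, hcm, hd, hD⟩ := exists_isSimple_isOfCMType_fourfold_not_isDivisorGenerated hreal
    exact ⟨X, hs, hcm, hd, 0, hD⟩
  · exact exists_isSimple_isOfCMType_not_isDivisorGenerated_powSucc_of_four_lt hreal h hn

end Converse

/-! ### §3 The dichotomy -/

section Dichotomy

/-- **THE DIMENSIONS OF SIMPLE CM ABELIAN VARIETIES WITH EXCEPTIONAL HODGE CLASSES ARE EXACTLY THE COMPOSITE
NUMBERS** (Ribet 1983 + Ribet 1980 (3.7) ⟹; Mumford–Pohlmann 1968 (`n = 4`) + Dodson 1984 §3.2.1 (`n > 4`) ⟸,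
the latter granted the existence of abelian varieties of every CM type, `hreal` = Shimura §6.2 Thm. 3): for
`n ≥ 1`, there is a SIMPLE complex abelian variety `X` OF CM TYPE with `dim X = n` and a power `X^{N+1}` which is NOT
divisor-generated — `B•(X^{N+1}) ≠ D•(X^{N+1})`, an exceptional Hodge class — if and only if `n` is not a prime and
`n ≥ 4`. [cite: Dodson1984, abstract and p. 2] [cite: Ribet1983, Thms. 0–3] [cite: Ribet1980, §3 Examples (3.7)]
[cite: Pohlmann1968, §3] [cite: Gordon1999HodgeAVSurvey, Thm. 6.3, Thm. 6.4 and 8.2] [cite: Shimura1998, §6.2 Thm. 3] -/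
theorem exists_isSimple_isOfCMType_not_isDivisorGenerated_powSucc_iff
    (hreal : Literature.NumberTheory.Automorphic.PicardCM.CMAbelianVarietyRealised) {n : ℕ} (hn : 0 < n) :
    (∃ X : AbelianVariety ℂ, X.IsSimple ∧ IsOfCMType X ∧ X.dim = n ∧
        ∃ N : ℕ, ¬ IsDivisorGenerated (X.powSucc N)) ↔ ¬ n.Prime ∧ 4 ≤ n := by
  constructor
  · rintro ⟨X, hs, hcm, hd, N, hN⟩
    subst hd
    exact not_prime_and_four_le_dim_of_not_isDivisorGenerated_powSucc X hs hn hcm hN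
  · rintro ⟨hp, h4⟩
    exact exists_isSimple_isOfCMType_not_isDivisorGenerated_powSucc_of_not_prime hreal h4 hp

/-- **The same dichotomy with «degenerate» in Dodson's sense** («the rank `t(Φ)` … is less than the maximal value of
`n + 1`»; Gordon 9.1 «`rank(K,S) := dim MT(A)`»): for `n ≥ 1`, there is a SIMPLE complex abelian variety `X` of CM
type, `dim X = n`, whose Mumford–Tate group has `dim MT(H¹(X)) < n + 1` (the Mumford–Tate rank of the `ℚ`-Hodge
structure on `H¹(X(ℂ); ℚ)`, real Hodge model `exists_isReal_hodgeModel_holds`) iff `n` is not a prime and `n ≥ 4` —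
through Hazama's criterion `Hdg(Xᵐ) = Div(Xᵐ) ∀ m ⟺ dim MT(X) = dim X + 1` (Gordon Thm. 6.4) and Kubota's bound
`dim MT(X) ≤ dim X + 1`; the direction ⟸ granted `hreal`. [cite: Dodson1984, abstract and p. 2]
[cite: Gordon1999HodgeAVSurvey, Thm. 6.4 and 9.1] [cite: Hazama1983, Theorem] [cite: Ribet1983, Thms. 0–3]
[cite: Deligne1982HodgeCycles, I Example 3.7] -/
theorem exists_isSimple_isOfCMType_mtRank_lt_iff
    (hreal : Literature.NumberTheory.Automorphic.PicardCM.CMAbelianVarietyRealised) {n : ℕ} (hn : 0 < n) :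
    (∃ (X : AbelianVariety ℂ) (hX : IsSmoothProjective n X.X), X.IsSimple ∧ IsOfCMType X ∧ X.dim = n ∧
        (haveI := BettiUniverse.finite hX 1
         @Motives.HodgeStructure.mtRank _ _ _ hodgeTensorFacts_holds.{0, 0} _ _
            (BettiUniverse.hodge exists_isReal_hodgeModel_holds hX 1) < n + 1)) ↔ ¬ n.Prime ∧ 4 ≤ n := by
  rw [← exists_isSimple_isOfCMType_not_isDivisorGenerated_powSucc_iff hreal hn]
  haveI : Motives.HodgeTensorFacts.{0, 0} := hodgeTensorFacts_holds.{0, 0}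
  constructor
  · rintro ⟨X, hX, hs, hcm, hd, hlt⟩
    refine ⟨X, hs, hcm, hd, ?_⟩
    by_contra hall
    push Not at hall
    have h0 : 0 < X.dim := by rw [hd]; exact hn
    have heq := (forall_isDivisorGenerated_powSucc_iff_mtRank_eq hX hs h0 hcm).1 hall
    rw [hd] at heq
    rw [heq] at hlt
    exact lt_irrefl _ hlt
  · rintro ⟨X, hs, hcm, hd, N, hN⟩
    have hX : IsSmoothProjective n X.X := hd ▸ (isSmoothProjective_holds (A := X))
    refine ⟨X, hX, hs, hcm, hd, ?_⟩
    have h0 : 0 < X.dim := by rw [hd]; exact hn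
    have hne : ¬ (haveI := BettiUniverse.finite hX 1
        (BettiUniverse.hodge exists_isReal_hodgeModel_holds hX 1).mtRank = X.dim + 1) :=
      fun h => hN ((forall_isDivisorGenerated_powSucc_iff_mtRank_eq hX hs h0 hcm).2 h N)
    have hle := mtRank_hodge_one_le_dim_add_one hX hs h0 hcm
    rw [hd] at hne hle
    exact lt_of_le_of_ne hle hne

end Dichotomy

end Literature.AlgebraicGeometry.Pohlmann1968

end
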